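import Summits.Langlands.Langlands.Statement
import Literature.NumberTheory.GaloisRepresentations.LAdicRepFrobenius
import Literature.NumberTheory.GaloisRepresentations.WeilDeligneRepMonodromyProofs
import Literature.RepresentationTheory.Semisimple.IrreducibleOfCharpoly
import Literature.NumberTheory.Automorphic.TunnellLemma
import Literature.NumberTheory.Automorphic.AutomorphicRepsGLSatakeFlathProofs
import HarnessLib

/-!
# The uniqueness clause of direction (A) of `Langlands` is a theorem

Summit `Langlands` (global Langlands reciprocity for `GL_n`, `Summits/Langlands/Langlands/Statement`),
direction (A) `Summit.Langlands.AutomorphicToGalois`: for an L-algebraic cuspidal `π` the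
representation `ρ = ρ_{π,ι}` is demanded *irreducible*, geometric, corresponding to `π`
(`Corresponds`: Satake–Frobenius matching at almost all places and local–global compatibility
at every finite place), **and unique up to `GL_n(ℚ̄_ℓ)`-conjugacy among all `ρ'` corresponding
to `π`** — with no semisimplicity or irreducibility hypothesis on `ρ'`.

This file proves, unconditionally (no named fact as hypothesis), that the uniqueness clause
follows from the other three: if `ρ` is irreducible and `ρ, ρ'` both correspond to `π`, then
`ρ'` is conjugate to `ρ` (`SoloBlind.isConjugate_of_corresponds`).  Consequently the summit is
equivalent to the same statement with the uniqueness clause deleted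
(`SoloBlind.langlands_iff_langlandsExists`): any proof of `Langlands` need only produce, for each
`π`, *some* irreducible geometric corresponding `ρ`, and prove direction (B).

Argument (Deligne–Serre 1974, Lemme 3.2; Darmon–Diamond–Taylor 1995, §2.1, in the `ℓ`-adic
setting):
1. at the cofinitely many places where both Satake clauses hold, the Satake parameter of `π` is
   unique (Flath; the tree's proved `AutomorphicRepData.hasSatakeParamAt_unique_holds`), so `ρ`
   and `ρ'` are unramified with the *same* characteristic polynomial of Frobenius
   (`SoloBlind.eventually_frobCharpoly_of_corresponds`);
2. Frobenius elements at the good places are dense in `Γ_K` (Chebotarev, proved in the tree: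
   `chebotarev_artinRep_of_galoisSide`, `absoluteGaloisGroup.frobenius_dense`) and the
   coefficients of the characteristic polynomial are continuous, so
   `det(X - ρ σ) = det(X - ρ' σ)` for **every** `σ ∈ Γ_K` (`SoloBlind.charpoly_eq_of_eventually`);
3. irreducibility is detected by characteristic polynomials (the tree's
   `isIrreducible_of_charpoly_eq`: semisimplification + Brauer–Nesbitt), so `ρ'` is irreducible,
   hence semisimple; Brauer–Nesbitt in characteristic `0`
   (`FramedGaloisRep.nonempty_equiv_of_hasFrobCharpolyAt_eventually`) gives an equivalence of the
   underlying continuous representations;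
4. an equivalence of the representations on `ℚ̄_ℓⁿ` underlying two framed representations is a
   change of frame (`SoloBlind.isConjugate_of_equiv`).

## References

* P. Deligne, J.-P. Serre, *Formes modulaires de poids 1*, Ann. Sci. ÉNS 7 (1974), Lemme 3.2.
  [DeligneSerreASENS1974]
* H. Darmon, F. Diamond, R. Taylor, *Fermat's Last Theorem*, CDM 1995, §2.1.
  [DarmonDiamondTaylor1995]
* K. Buzzard, T. Gee, *The conjectural connections between automorphic representations and
  Galois representations*, LMS LNS 414 (2014), Conj. 3.2.1–3.2.2. [BuzzardGeeLMS2014]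
-/

open scoped MatrixGroups Matrix Classical Polynomial NumberField
open NumberField IsDedekindDomain Field Polynomial Filter
open Literature.NumberTheory.Automorphic Literature.NumberTheory.GaloisRepresentations

noncomputable section

namespace Summit.Langlands.Langlands.Theorems

namespace SoloBlind

/-! ## Change of frame from an equivalence -/

section Frame

variable {G : Type*} [Group G] [TopologicalSpace G] {A : Type*} [Field A] [TopologicalSpace A]
  [IsTopologicalRing A] {n : ℕ}

/-- An equivalence of the representations on `Aⁿ` underlying two framed representations
`ρ, ρ' : G →ₜ* GL_n(A)` is a change of frame: `ρ' = P ρ P⁻¹` with `P` the matrix of the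
equivalence. [folklore] -/
theorem isConjugate_of_equiv (ρ ρ' : FramedRep G A n)
    (e : ContinuousRep.Equiv ρ.toContinuousRep ρ'.toContinuousRep) :
    ∃ P : GL (Fin n) A, FramedRep.conj P ρ = ρ' := by
  set M : Matrix (Fin n) (Fin n) A := LinearMap.toMatrix' e.toLinearEquiv.toLinearMap with hM
  set M' : Matrix (Fin n) (Fin n) A := LinearMap.toMatrix' e.toLinearEquiv.symm.toLinearMap
    with hM'
  have hMM' : M * M' = 1 := by
    rw [hM, hM', ← LinearMap.toMatrix'_comp, LinearEquiv.comp_symm, LinearMap.toMatrix'_id]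
  have hM'M : M' * M = 1 := by
    rw [hM, hM', ← LinearMap.toMatrix'_comp, LinearEquiv.symm_comp, LinearMap.toMatrix'_id]
  let P : GL (Fin n) A := ⟨M, M', hMM', hM'M⟩
  refine ⟨P, ?_⟩
  ext σ : 1
  apply Units.ext
  -- the matrix of `e` applied to a vector is `e` of the vector
  have h1 : ∀ w : Fin n → A, M *ᵥ w = e.toLinearEquiv w := fun w ↦ by
    rw [hM, LinearMap.toMatrix'_mulVec]
    rfl
  -- the equivariance `e (ρ σ v) = ρ' σ (e v)` in matrix form: `M * ρ σ = ρ' σ * M`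
  have hcomm : M * ((ρ σ : GL (Fin n) A) : Matrix (Fin n) (Fin n) A) =
      ((ρ' σ : GL (Fin n) A) : Matrix (Fin n) (Fin n) A) * M := by
    refine (Matrix.toLin' (R := A)).injective (LinearMap.ext fun v ↦ ?_)
    rw [Matrix.toLin'_apply, Matrix.toLin'_apply, ← Matrix.mulVec_mulVec, ← Matrix.mulVec_mulVec,
      h1, h1]
    exact e.apply_apply σ v
  rw [FramedRep.conj_apply, Units.val_mul, Units.val_mul]
  change M * ((ρ σ : GL (Fin n) A) : Matrix (Fin n) (Fin n) A) * M' = _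
  rw [hcomm, Matrix.mul_assoc, hMM', Matrix.mul_one]

end Frame

/-! ## Equality of characteristic polynomials everywhere, from almost all places -/

section Charpoly

variable {K : Type} [Field K] [NumberField K] {A : Type*} [Field A] [TopologicalSpace A]
  [IsTopologicalRing A] {n : ℕ}

/-- **Frobenius density + continuity of the characteristic polynomial.** Two framed Galois
representations of a number field over a Hausdorff topological field which, at all but
finitely many places, are unramified with a common characteristic polynomial of Frobenius have
the same characteristic polynomial at every `σ ∈ Γ_K` (no semisimplicity needed). Chebotarev is
the tree's proved `chebotarev_artinRep_of_galoisSide`. [folklore] -/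
theorem charpoly_eq_of_eventually [T2Space A] (r r' : FramedGaloisRep K A n)
    (h : ∀ᶠ v : HeightOneSpectrum (𝓞 K) in cofinite,
      r.IsUnramifiedAt v ∧ r'.IsUnramifiedAt v ∧
        ∃ P : Polynomial A, r.HasFrobCharpolyAt v P ∧ r'.HasFrobCharpolyAt v P) (σ : absoluteGaloisGroup K) :
    FramedRep.charpoly r σ = FramedRep.charpoly r' σ := by
  classical
  set S : Set (HeightOneSpectrum (𝓞 K)) := {v | ¬ (r.IsUnramifiedAt v ∧ r'.IsUnramifiedAt v ∧
      ∃ P : Polynomial A, r.HasFrobCharpolyAt v P ∧ r'.HasFrobCharpolyAt v P)}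
    with hSdef
  have hS : S.Finite := Filter.eventually_cofinite.1 h
  set D : Set (absoluteGaloisGroup K) :=
    {σ | ∃ v ∉ S, ∃ 𝔓 ∈ v.primesAbove, IsArithFrobAt (𝓞 K) σ 𝔓} with hDdef
  have hF : D ⊆ {σ | FramedRep.charpoly r σ = FramedRep.charpoly r' σ} := by
    rintro τ ⟨v, hv, 𝔓, h𝔓, hτ⟩
    simp only [hSdef, Set.mem_setOf_eq, not_not] at hv
    obtain ⟨-, -, P, hP, hP'⟩ := hv
    exact (hP 𝔓 h𝔓 τ hτ).trans (hP' 𝔓 h𝔓 τ hτ).symm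
  have hcont : ∀ (ρ : FramedGaloisRep K A n) (i : ℕ),
      Continuous fun τ : absoluteGaloisGroup K ↦ (FramedRep.charpoly ρ τ).coeff i := fun ρ i ↦
    (Monodromy.continuous_charpoly_coeff i).comp (Units.continuous_val.comp (map_continuous ρ))
  have hclosed :
      IsClosed {τ : absoluteGaloisGroup K | FramedRep.charpoly r τ = FramedRep.charpoly r' τ} := by
    have hset : {τ : absoluteGaloisGroup K | FramedRep.charpoly r τ = FramedRep.charpoly r' τ} =
        ⋂ i : ℕ, {τ | (FramedRep.charpoly r τ).coeff i = (FramedRep.charpoly r' τ).coeff i} := by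
      ext τ
      simp only [Set.mem_setOf_eq, Set.mem_iInter]
      exact ⟨fun h i ↦ by rw [h], fun h ↦ Polynomial.ext h⟩
    rw [hset]
    exact isClosed_iInter fun i ↦ isClosed_eq (hcont r i) (hcont r' i)
  have hmem : σ ∈ closure D := by
    rw [(absoluteGaloisGroup.frobenius_dense chebotarev_artinRep_of_galoisSide K S hS).closure_eq]
    exact Set.mem_univ σ
  exact hclosed.closure_subset_iff.2 hF hmem

/-- If `r` is irreducible and `r'` has the Frobenius characteristic polynomials of `r` at almost
all places, then `r'` is irreducible too ("`ρ^{ss}` irreducible ⇒ `ρ` irreducible",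
Darmon–Diamond–Taylor 1995, §2.1; the tree's `isIrreducible_of_charpoly_eq`).
[cite: DarmonDiamondTaylor1995, §2.1] -/
theorem isIrreducible_of_eventually [T2Space A] (r r' : FramedGaloisRep K A n)
    (hr : r.toGaloisRep.IsIrreducible)
    (h : ∀ᶠ v : HeightOneSpectrum (𝓞 K) in cofinite,
      r.IsUnramifiedAt v ∧ r'.IsUnramifiedAt v ∧
        ∃ P : Polynomial A, r.HasFrobCharpolyAt v P ∧ r'.HasFrobCharpolyAt v P) :
    r'.toGaloisRep.IsIrreducible :=
  Literature.RepresentationTheory.Semisimple.isIrreducible_of_charpoly_eq r'.toMonoidHom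
    r.toMonoidHom (fun σ ↦ (charpoly_eq_of_eventually r r' h σ).symm) hr

omit [NumberField K] [IsTopologicalRing A] in
/-- An irreducible framed representation is semisimple (a simple lattice of subrepresentations is
complemented). [folklore] -/
theorem isSemisimple_of_isIrreducible [IsTopologicalRing A] (r : FramedGaloisRep K A n)
    (hr : r.toGaloisRep.IsIrreducible) : r.toGaloisRep.IsSemisimple := by
  haveI : Representation.IsIrreducible r.toGaloisRep.toRepresentation := hr
  change Representation.IsSemisimpleRepresentation r.toGaloisRep.toRepresentation
  infer_instance

/-- **Irreducible Galois representations are determined up to conjugacy by almost all Frobenius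
characteristic polynomials** (coefficients in a Hausdorff field of characteristic `0`), with no
hypothesis on the second representation. [cite: DeligneSerreASENS1974, Lemme 3.2 (p. 513)] -/
theorem isConjugate_of_eventually [T2Space A] [CharZero A] (r r' : FramedGaloisRep K A n)
    (hr : r.toGaloisRep.IsIrreducible)
    (h : ∀ᶠ v : HeightOneSpectrum (𝓞 K) in cofinite,
      r.IsUnramifiedAt v ∧ r'.IsUnramifiedAt v ∧
        ∃ P : Polynomial A, r.HasFrobCharpolyAt v P ∧ r'.HasFrobCharpolyAt v P) :
    ∃ P : GL (Fin n) A, FramedRep.conj P r = r' := by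
  have hr' : r'.toGaloisRep.IsIrreducible := isIrreducible_of_eventually r r' hr h
  obtain ⟨e⟩ := FramedGaloisRep.nonempty_equiv_of_hasFrobCharpolyAt_eventually
    chebotarev_artinRep_of_galoisSide r r' (isSemisimple_of_isIrreducible r hr)
    (isSemisimple_of_isIrreducible r' hr') h
  exact isConjugate_of_equiv r r' e

end Charpoly

/-! ## The uniqueness clause of (A) -/

section Summit

variable {n : ℕ} {K : Type} [Field K] [NumberField K]
  {hcpt : isCompact_glFiniteIntegralLevel n K} {ℓ : ℕ} [Fact ℓ.Prime]

/-- Two representations corresponding to the same automorphic `π` are unramified with the same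
characteristic polynomial of Frobenius at all but finitely many places (uniqueness of Satake
parameters, Flath 1979 Thm. 3 — the tree's proved `hasSatakeParamAt_unique_holds`).
[cite: BuzzardGeeLMS2014, Conj. 3.2.1] -/
theorem eventually_frobCharpoly_of_corresponds {𝓡 : ReciprocityData K} {ι : PadicAlgCl ℓ ≃+* ℂ}
    {π : AutomorphicRepData (AutomorphyDatum.gl n K hcpt)}
    {ρ ρ' : FramedGaloisRep K (PadicAlgCl ℓ) n}
    (h : Corresponds 𝓡 ι π ρ) (h' : Corresponds 𝓡 ι π ρ') :
    ∀ᶠ v : HeightOneSpectrum (𝓞 K) in cofinite,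
      ρ.IsUnramifiedAt v ∧ ρ'.IsUnramifiedAt v ∧
        ∃ P : Polynomial (PadicAlgCl ℓ), ρ.HasFrobCharpolyAt v P ∧ ρ'.HasFrobCharpolyAt v P := by
  filter_upwards [h.1, h'.1] with v ⟨α, hα, hur, hP⟩ ⟨α', hα', hur', hP'⟩
  obtain rfl : α = α' := π.hasSatakeParamAt_unique_holds hα hα'
  exact ⟨hur, hur', _, hP, hP'⟩

/-- **The uniqueness clause of direction (A) of `Langlands` is automatic**: if `ρ` is irreducible
and `ρ`, `ρ'` both correspond to `π` (via `ι`), then `ρ'` is `GL_n(ℚ̄_ℓ)`-conjugate to `ρ`.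
Unconditional (Chebotarev, Brauer–Nesbitt, Flath's uniqueness of Satake parameters are theorems
of the tree). [cite: DeligneSerreASENS1974, Lemme 3.2 (p. 513)] -/
theorem isConjugate_of_corresponds {𝓡 : ReciprocityData K} {ι : PadicAlgCl ℓ ≃+* ℂ}
    {π : AutomorphicRepData (AutomorphyDatum.gl n K hcpt)}
    {ρ ρ' : FramedGaloisRep K (PadicAlgCl ℓ) n} (hρ : ρ.toGaloisRep.IsIrreducible)
    (h : Corresponds 𝓡 ι π ρ) (h' : Corresponds 𝓡 ι π ρ') : IsConjugate ρ ρ' :=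
  isConjugate_of_eventually ρ ρ' hρ (eventually_frobCharpoly_of_corresponds h h')

/-- A second irreducibility transfer: any `ρ'` corresponding to the same `π` as an irreducible
`ρ` is irreducible. [cite: DarmonDiamondTaylor1995, §2.1] -/
theorem isIrreducible_of_corresponds {𝓡 : ReciprocityData K} {ι : PadicAlgCl ℓ ≃+* ℂ}
    {π : AutomorphicRepData (AutomorphyDatum.gl n K hcpt)}
    {ρ ρ' : FramedGaloisRep K (PadicAlgCl ℓ) n} (hρ : ρ.toGaloisRep.IsIrreducible)
    (h : Corresponds 𝓡 ι π ρ) (h' : Corresponds 𝓡 ι π ρ') : ρ'.toGaloisRep.IsIrreducible :=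
  isIrreducible_of_eventually ρ ρ' hρ (eventually_frobCharpoly_of_corresponds h h')

/-- **Direction (A) is equivalent to its existence part**: (A) holds iff every L-algebraic
cuspidal `π` has, for all `ℓ, ι`, *some* irreducible geometric `ρ` corresponding to it at every
finite place (the conjugacy-uniqueness clause is then automatic, `isConjugate_of_corresponds`).
[cite: DeligneSerreASENS1974, Lemme 3.2 (p. 513)] -/
theorem automorphicToGalois_iff_exists (𝓡 : ReciprocityData K)
    (hcpt : isCompact_glFiniteIntegralLevel n K) :
    AutomorphicToGalois n 𝓡 hcpt ↔
      ∀ π : CuspidalAutomorphicRepData n K hcpt, π.1.IsLAlgebraic →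
        ∀ (ℓ : ℕ) [Fact ℓ.Prime] (ι : PadicAlgCl ℓ ≃+* ℂ),
          ∃ ρ : FramedGaloisRep K (PadicAlgCl ℓ) n,
            ρ.toGaloisRep.IsIrreducible ∧ IsGeometricFramed 𝓡 ρ ∧ Corresponds 𝓡 ι π.1 ρ := by
  refine ⟨fun h π hπ ℓ _ ι ↦ ?_, fun h π hπ ℓ _ ι ↦ ?_⟩
  · obtain ⟨ρ, hirr, hgeo, hc, -⟩ := h π hπ ℓ ι
    exact ⟨ρ, hirr, hgeo, hc⟩
  · obtain ⟨ρ, hirr, hgeo, hc⟩ := h π hπ ℓ ι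
    exact ⟨ρ, hirr, hgeo, hc, fun ρ' hc' ↦ isConjugate_of_corresponds hirr hc hc'⟩

end Summit

/-- **The summit is equivalent to its existence form** — `Langlands` with the
uniqueness-up-to-conjugacy clause of (A) deleted (same quantifier shape otherwise): the clause
carries no content beyond existence + irreducibility, so any proof of `Langlands` need only
construct, for each L-algebraic cuspidal `π`, some irreducible geometric `ρ` corresponding to it,
and prove (B). [cite: DeligneSerreASENS1974, Lemme 3.2 (p. 513)] -/
theorem langlands_iff_langlandsExists :
    Langlands ↔
      ∀ (F : Type) [Field F] [NumberField F],
        Nonempty (Summit.Langlands.ReciprocityData F) ∧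
          ∀ (𝓡 : Summit.Langlands.ReciprocityData F) (n : ℕ), 0 < n →
            ∀ hcpt : isCompact_glFiniteIntegralLevel n F,
              (∀ π : CuspidalAutomorphicRepData n F hcpt, π.1.IsLAlgebraic →
                ∀ (ℓ : ℕ) [Fact ℓ.Prime] (ι : PadicAlgCl ℓ ≃+* ℂ),
                  ∃ ρ : FramedGaloisRep F (PadicAlgCl ℓ) n,
                    ρ.toGaloisRep.IsIrreducible ∧ IsGeometricFramed 𝓡 ρ ∧ Corresponds 𝓡 ι π.1 ρ) ∧
              GaloisToAutomorphic n 𝓡 hcpt := by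
  refine ⟨fun h F _ _ ↦ ?_, fun h F _ _ ↦ ?_⟩
  · obtain ⟨hne, hall⟩ := h F
    exact ⟨hne, fun 𝓡 n hn hcpt ↦
      ⟨(automorphicToGalois_iff_exists 𝓡 hcpt).1 (hall 𝓡 n hn hcpt).1, (hall 𝓡 n hn hcpt).2⟩⟩
  · obtain ⟨hne, hall⟩ := h F
    exact ⟨hne, fun 𝓡 n hn hcpt ↦
      ⟨(automorphicToGalois_iff_exists 𝓡 hcpt).2 (hall 𝓡 n hn hcpt).1, (hall 𝓡 n hn hcpt).2⟩⟩

/-- **Direction (B) plus the existence half of (A) settle the summit** (the usable corollary: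
a proof of `Langlands` may skip the conjugacy-uniqueness clause).
[cite: DeligneSerreASENS1974, Lemme 3.2 (p. 513)] -/
theorem langlands_of_exists
    (h : ∀ (F : Type) [Field F] [NumberField F],
      Nonempty (Summit.Langlands.ReciprocityData F) ∧
        ∀ (𝓡 : Summit.Langlands.ReciprocityData F) (n : ℕ), 0 < n →
          ∀ hcpt : isCompact_glFiniteIntegralLevel n F,
            (∀ π : CuspidalAutomorphicRepData n F hcpt, π.1.IsLAlgebraic →
              ∀ (ℓ : ℕ) [Fact ℓ.Prime] (ι : PadicAlgCl ℓ ≃+* ℂ),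
                ∃ ρ : FramedGaloisRep F (PadicAlgCl ℓ) n,
                  ρ.toGaloisRep.IsIrreducible ∧ IsGeometricFramed 𝓡 ρ ∧ Corresponds 𝓡 ι π.1 ρ) ∧
            GaloisToAutomorphic n 𝓡 hcpt) :
    Langlands :=
  langlands_iff_langlandsExists.2 h

end SoloBlind

end Summit.Langlands.Langlands.Theorems

end
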